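import Summits.QuantumAdvantage.QuantumAdvantage.Theorems.ResponseDialA

/-! # ResponseDialB — part 2/5 (mechanical split for landing of `ResponseDial`; content verbatim; scopes re-opened with their variables) -/

set_option linter.dupNamespace false
noncomputable section
open scoped Classical

namespace Summit.QuantumAdvantage.QuantumAdvantage.Theorems.ResponseDial
open Finset
open Literature.Computability.QuantumComplexity Literature.Computability.QuantumComplexity.RingHLF
open Literature.Computability.MetaComplexity Literature.Computability.MetaComplexity.Smolensky
open Summit.QuantumAdvantage.AdviceFreeQNC0
open Summit.QuantumAdvantage.QuantumAdvantage.Theorems.AnchorDial (outB dev cN orbF orbL orbL_cons fz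
  cN_orbF_cast oddZeros_orbF win_iff gCond_iff_cN card_filter_orbF orbF_false flip2 card_odd_ge loss_shape_mono)
open Summit.QuantumAdvantage.QuantumAdvantage.Theorems.AnchorDial.Core (ct sg)
open Summit.QuantumAdvantage.QuantumAdvantage.Theorems.HolonomyDial (gCond tPoly tPoly_apply tPoly_mem card_odd_le
  xorP xorP_mem xorP_apply_bool mono_singleton_apply indP indP_mem indP_apply)
open Summit.QuantumAdvantage.QuantumAdvantage.Theorems.StabilizerDial (apIdx apStrat apStrat_mem bitP bitP_apStrat
  pad rel_pad_iff outB_pad_zero pad_mem StabFew rowMask bitP_pad mem_dev_pad_apStrat_iff BlockRec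
  blockSelect_of_fewLocus goodBound_of_blockRec fibreIdentityAt_of_block oddSliceBound_holds eventually_polylog
  side_bounds)
open Summit.QuantumAdvantage.QuantumAdvantage.Theorems.LocusDial (Coverable FewLocus)
open Summit.QuantumAdvantage.QuantumAdvantage.Theorems.SparsityDial (real_loss_of_frac AntipodalLoss3 stabFew_mono_mr
  one_le_logpow)
open Summit.QuantumAdvantage.QuantumAdvantage.Theses.SparsityDial (DenseGenericLoss3)

/-! ## §3  Closed form of the orbit map; disjointly supported responses. -/

section OrbitForm
variable {N F : ℕ}

/-- closed form of a chain of optional adjacent pair-flips at pairwise separated sites. -/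
theorem orbL_apply (x : Fin N → Bool) (j : Fin N) : ∀ l : List (Bool × ℕ),
    l.Pairwise (fun p q => p.2 + 2 ≤ q.2 ∨ q.2 + 2 ≤ p.2) →
      orbL l x j = if (∃ p ∈ l, p.1 = true ∧ (j.val = p.2 ∨ j.val = p.2 + 1)) then !x j else x j
  | [] => by intro _; simp [orbL]
  | p :: l => by
      intro hl
      rw [List.pairwise_cons] at hl
      obtain ⟨hp, hl'⟩ := hl
      have ih := orbL_apply x j l hl'
      rw [orbL_cons]
      obtain ⟨e, a⟩ := p
      cases e
      · -- no flip at this site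
        rw [show fz false a (orbL l x) = orbL l x from rfl, ih]
        by_cases h : ∃ q ∈ l, q.1 = true ∧ (j.val = q.2 ∨ j.val = q.2 + 1)
        · rw [if_pos h, if_pos]
          obtain ⟨q, hq, h'⟩ := h
          exact ⟨q, List.mem_cons_of_mem _ hq, h'⟩
        · rw [if_neg h, if_neg]
          rintro ⟨q, hq, h1, h2⟩
          rw [List.mem_cons] at hq
          rcases hq with rfl | hq
          · exact Bool.false_ne_true h1
          · exact h ⟨q, hq, h1, h2⟩
      · -- flip at this site
        rw [show fz true a (orbL l x) = flip2 a (a + 1) (orbL l x) from rfl]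
        unfold Summit.QuantumAdvantage.QuantumAdvantage.Theorems.AnchorDial.flip2
        by_cases hj : j.val = a ∨ j.val = a + 1
        · rw [if_pos hj, ih, if_neg, if_pos]
          · exact ⟨(true, a), List.mem_cons_self, rfl, hj⟩
          · rintro ⟨q, hq, h1, h2⟩
            have := hp q hq
            simp only at this
            omega
        · rw [if_neg hj, ih]
          by_cases h : ∃ q ∈ l, q.1 = true ∧ (j.val = q.2 ∨ j.val = q.2 + 1)
          · rw [if_pos h, if_pos]
            obtain ⟨q, hq, h'⟩ := h
            exact ⟨q, List.mem_cons_of_mem _ hq, h'⟩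
          · rw [if_neg h, if_neg]
            rintro ⟨q, hq, h1, h2⟩
            rw [List.mem_cons] at hq
            rcases hq with rfl | hq
            · exact hj h2
            · exact h ⟨q, hq, h1, h2⟩

/-- closed form of the orbit point: the bits of the flagged sites are complemented. -/
theorem orbF_apply {b : Fin F → ℕ} (hb : ∀ i j : Fin F, i < j → b i + 2 ≤ b j) (ε : Fin F → Bool)
    (x : Fin N → Bool) (j : Fin N) :
    orbF b ε x j = if (∃ i, ε i = true ∧ (j.val = b i ∨ j.val = b i + 1)) then !x j else x j := by
  unfold Summit.QuantumAdvantage.QuantumAdvantage.Theorems.AnchorDial.orbF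
  have hpw : (List.ofFn fun i => (ε i, b i)).Pairwise (fun p q => p.2 + 2 ≤ q.2 ∨ q.2 + 2 ≤ p.2) :=
    List.pairwise_ofFn.2 fun i j hij => Or.inl (hb i j hij)
  rw [orbL_apply x j _ hpw]
  have hiff : (∃ p ∈ List.ofFn (fun i => (ε i, b i)), p.1 = true ∧ (j.val = p.2 ∨ j.val = p.2 + 1)) ↔
      ∃ i, ε i = true ∧ (j.val = b i ∨ j.val = b i + 1) := by
    constructor
    · rintro ⟨p, hp, h⟩
      rw [List.mem_ofFn] at hp
      obtain ⟨i, rfl⟩ := hp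
      exact ⟨i, h⟩
    · rintro ⟨i, h⟩
      exact ⟨(ε i, b i), List.mem_ofFn.2 ⟨i, rfl⟩, h⟩
  by_cases h : ∃ i, ε i = true ∧ (j.val = b i ∨ j.val = b i + 1)
  · rw [if_pos h, if_pos (hiff.2 h)]
  · rw [if_neg h, if_neg (mt hiff.1 h)]

/-- with pairwise disjoint response sets, the response parity is the indicator of "some flagged site responds". -/
theorem resp_even_iff (R : Fin 5 → Finset (Fin N)) (hR : ∀ i j, i ≠ j → Disjoint (R i) (R j))
    (ε : Fin 5 → Bool) (k : Fin N) :
    (univ.filter fun i : Fin 5 => ε i = true ∧ k ∈ R i).card % 2 = 0 ↔ ¬ ∃ i, ε i = true ∧ k ∈ R i := by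
  have hle : (univ.filter fun i : Fin 5 => ε i = true ∧ k ∈ R i).card ≤ 1 := by
    refine Finset.card_le_one.2 fun i hi j hj => ?_
    rw [mem_filter] at hi hj
    by_contra hne
    exact disjoint_left.1 (hR i j hne) hi.2.2 hj.2.2
  constructor
  · rintro h ⟨i, hi⟩
    have hpos : 0 < (univ.filter fun i : Fin 5 => ε i = true ∧ k ∈ R i).card :=
      card_pos.2 ⟨i, mem_filter.2 ⟨mem_univ _, hi⟩⟩
    omega
  · intro h
    have he : (univ.filter fun i : Fin 5 => ε i = true ∧ k ∈ R i) = ∅ :=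
      filter_eq_empty_iff.2 fun i _ hi => h ⟨i, hi⟩
    rw [he]; rfl

end OrbitForm

/-! ## §4  THE ANTIPODAL RUNG: `AntipodalLoss3` (the BC5 rung of `D`, SparsityDial §5) is a THEOREM.
The antipodal family `t_j ⊕ x_{j+⌊N/2⌋}` reads every bit exactly once; flipping the adjacent pair at a second-half
site toggles the deviation status of exactly its two first-half readers — an ADDITIVE response — so the orbit law
applies at every odd input: `#odd ≤ 32·#odd losers`, loss `≥ 2^{n-1}/n` (`C = 1`). -/

section Antipodal
variable {N : ℕ}

/-- deviation set of the (unpadded) antipodal family: position `k` deviates iff its antipodal bit is set. -/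
theorem mem_dev_apStrat (y : Fin N → Bool) (k : Fin N) :
    k ∈ dev (fun i : Fin N => apStrat i) y ↔ y (apIdx k) = true := by
  unfold Summit.QuantumAdvantage.QuantumAdvantage.Theorems.AnchorDial.dev
  rw [mem_filter]
  show (k ∈ (univ : Finset (Fin N)) ∧ bitP (apStrat k) y ≠ tGuess y k) ↔ _
  rw [bitP_apStrat]
  simp only [mem_univ, true_and]
  cases tGuess y k <;> cases y (apIdx k) <;> decide

/-- five separated second-half flip sites `⌊n/2⌋ + 2i`. -/
def apSite (n : ℕ) (i : Fin 5) : ℕ := n / 2 + 2 * i.val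

/-- their first-half reader pairs. -/
def apResp (n : ℕ) (i : Fin 5) : Finset (Fin n) :=
  univ.filter fun k => (apIdx k).val = apSite n i ∨ (apIdx k).val = apSite n i + 1

/-- ResponseDialB helper `apSite_sep` (decomp-qadv land package; see the module docstring). -/
theorem apSite_sep (n : ℕ) : ∀ i j : Fin 5, i < j → apSite n i + 2 ≤ apSite n j := by
  intro i j hij
  have : i.val < j.val := hij
  unfold apSite; omega

/-- ResponseDialB helper `apSite_le` (decomp-qadv land package; see the module docstring). -/
theorem apSite_le (n : ℕ) (hn : 22 ≤ n) : ∀ i : Fin 5, apSite n i + 3 ≤ n := by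
  intro i
  have := i.isLt
  unfold apSite; omega

/-- ResponseDialB helper `apResp_disjoint` (decomp-qadv land package; see the module docstring). -/
theorem apResp_disjoint (n : ℕ) : ∀ i j : Fin 5, i ≠ j → Disjoint (apResp n i) (apResp n j) := by
  intro i j hij
  rw [Finset.disjoint_left]
  intro k hi hj
  unfold apResp at hi hj
  rw [mem_filter] at hi hj
  have hne : i.val ≠ j.val := fun h => hij (Fin.ext h)
  unfold apSite at hi hj
  omega

/-- the antipodal family responds additively at EVERY input. -/
theorem apStrat_addResp (n : ℕ) (x : Fin n → Bool) :
    AddResp (apSite n) (fun i : Fin n => apStrat i) (apResp n) x := by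
  intro ε k
  rw [mem_dev_apStrat, mem_dev_apStrat, orbF_apply (apSite_sep n) ε x (apIdx k),
    resp_even_iff (apResp n) (apResp_disjoint n) ε k]
  have hiff : (∃ i, ε i = true ∧ k ∈ apResp n i) ↔
      ∃ i, ε i = true ∧ ((apIdx k).val = apSite n i ∨ (apIdx k).val = apSite n i + 1) := by
    simp only [apResp, mem_filter, mem_univ, true_and]
  rw [hiff]
  by_cases h : ∃ i, ε i = true ∧ ((apIdx k).val = apSite n i ∨ (apIdx k).val = apSite n i + 1)
  · rw [if_pos h]
    cases x (apIdx k) <;> simp [h]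
  · rw [if_neg h]
    simp [h]

/-- **antipodal counting law**: `#odd ≤ 32 · #{odd losers of the antipodal family}` for `n ≥ 22`. -/
theorem antipodal_loss_count (n : ℕ) (hn : 22 ≤ n) :
    (univ.filter fun x : Fin n → Bool => OddZeros x).card ≤
      32 * (univ.filter fun x : Fin n → Bool =>
        OddZeros x ∧ ¬ Rel x (outB (fun i : Fin n => apStrat i) x)).card := by
  refine le_trans (card_le_card fun x hx => ?_)
    (additive_loss_count (N := n) (by omega) (apSite_sep n) (apSite_le n hn) (fun i : Fin n => apStrat i))
  rw [mem_filter] at hx ⊢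
  exact ⟨mem_univ _, hx.2, apResp n, apStrat_addResp n x⟩

/-- **RUNG `AntipodalLoss3` PROVED** (`C = 1`, `n₀ = 32`): the antipodal family is not near-perfect. -/
theorem antipodalLoss3 : AntipodalLoss3 :=
  ⟨1, 32, fun n hn => real_loss_of_frac (M := 32) (by norm_num) hn (by omega) (fun i : Fin n => apStrat i)
    (antipodal_loss_count n (by omega))⟩

end Antipodal



end Summit.QuantumAdvantage.QuantumAdvantage.Theorems.ResponseDial
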